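import Literature.MathematicalPhysics.QuantumFieldTheory.Balaban1983to89.B7Prop3GeneralRotated
import Literature.MathematicalPhysics.QuantumFieldTheory.Balaban1983to89.B7Prop5GeneralOperators

/-!
# `Balaban1983to89.B7Ineq139PathMass` — T. Bałaban, *Averaging operations for lattice gauge theories*, Commun. Math. Phys.
**98** (1985) 17–51 [Balaban1985Averaging]: the `ℓ¹` CONTOUR MASSES behind **(139)** — «|Q_{V₀}A| ≦ Q|A|, |Q″(V₀)A| ≦
C′₁L²α₀Q″|A|» — file 1/2 of row B7.Eq139 at a general background (file 2 = `B7Ineq139General`)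

statement-level skeleton of published theorems with citation tags; proofs where landed; nothing here is a claim about the Yang–Mills mass gap

PDF held: `paper:balaban1985-cmp98-averaging` (journal page = PDF page + 16); p. 39 [PDF 23] ((139)–(140)), p. 36 [PDF 20]
((124)–(126)), p. 34 [PDF 18] ((115)), p. 19 [PDF 3] ((14)) read from the materialised text layer
`~/.lit/texts/paper-balaban1985-cmp98-averaging/p0023.txt` and the renders `b2b-balaban-ref1/pages/1985-cmp98-averaging/…`.

CITATION HEADER / WHAT IS REPRODUCED.  SKELETON row **B7.Eq139** («(139), (142)–(147)»; cell `lit-balaban`, HOME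
`run/shared/lean/pub/lit-balaban/`, seat p06 gen 3 = unit `lit-balaban-p06`; owner r04, referee ref-4).  p. 39, verbatim:
*"The linear part of the one-step renormalization transformation is given by the formula (124). It is a sum of the main term
Q_{V₀}A given by (125) and a remainder which we will denote by Q″(V₀)A. From (124) it is clear that we have the inequalities
|Q_{V₀}A| ≦ Q|A|, |Q″(V₀)A| ≦ C′₁L²α₀Q″|A|, (139) where the operator Q is defined as in [2], and Q″ is defined as (Q″A)_c =
Σ_{b⊂B(c₋)∪B(c₊)} L^{−d}A_b. (140) The constant C′₁ depends on d and L."*  «From (124) it is clear» unpacks as: every term of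
(124)/(125) is a rotated contour sum `(R_{0,·}A)(Γ)` ((58), `B7Prop3GeneralRotated.tsum`) over a contour `Γ` of (14)/(115)
— the tree contours `Γ_{c₋,x}`, `Γ_{c₊,x′}`, the segment `[x, x′]`, the bond `c` — each a MONOTONE lattice walk inside
`B(c₋) ∪ B(c₊)`; the rotations do not increase norms, so each is bounded by its `ℓ¹` MASS `Σ_{b⊂Γ}|A_b|` (this file), which
is `≦ Σ_{b⊂B(c₋)∪B(c₊)}|A_b| = Lᵈ(Q″|A|)_c`, and for the main term (125) the segment masses sum to EXACTLY `L·(Q|A|)_c`.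

DICTIONARY (conventions of `B7Prop5Flat` / `B7Prop5GeneralOperators`, every lattice rescaled to `ℤᵈ`): the coarse bond
`c = ⟨q, q + Le_κ⟩` with corner `q`; «b ⊂ B(c₋) ∪ B(c₊)» ↦ `b ∈ S1 L q κ` (both endpoints in the box `[q, q + (L−1)𝟙 + Le_κ]`);
`L·(Q|A|)_c` ↦ `avQ L |A| q κ`, `(Q″|A|)_c` ↦ `ddQ L |A| q κ` ((139)'s `Q` of [2] (1.11) times the un-normalisation `L` of
(122), and (140)); `|A|` ↦ the real bond function `fun x κ ↦ ‖A x κ‖`.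

WHAT THIS FILE PROVES (kernel, 0 sorry, standard axioms; data defs `massSite`, `pathMass`, `pathBonds` only — no `Prop`
fact): §1 `norm_tsum_le_pathMass` (`‖(R_{0,x}A)(Γ)‖ ≤ Σ_{b⊂Γ}|A_b|` over a `U1` background); §2 `pathMass_le_sum` (a
monotone walk's bonds are pairwise distinct, so its mass is `≤ Σ_{b∈T}|A_b|` for any covering bond set `T`); §3 the
contours of (115)/(124)/(125) live in `S1 L q κ` (`pathBonds_treeWord_subset`, `pathBonds_treeWord_subset'`,
`pathBonds_seg_subset`), `sum_S1_eq_ddQ` (`Σ_{b∈S1}|A_b| = Lᵈ·ddQ`), the piece bounds `pathMass_treeWord_le(')`,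
`pathMass_seg_le`, and `sum_pathMass_seg_eq_avQ` (`Σ_x L^{−d} Σ_{b⊂[x,x(c)]}|A_b| = avQ L |A| (c)` EXACTLY).
DIVERGENCES from print: none of substance (bookkeeping of finite lattice walks); corner blocks on `ℤᵈ` as in the lineage.
RELATION TO THE SUBSTRATE: the substrate cell proves (139) Summits-side (`Support/ShellMeasureAveragePathMass`/`…Majorant`,
over `B7BlockGeometry.Qav/Qdd`); this Literature reproduction is written for the `avQ`/`ddQ` currency of the Literature
consumers `B7Prop5GeneralLinear`/`B7Prop5GeneralInduction` (their binder `h139`), re-declares no substrate name, and moves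
nothing (INTERFACES IF2-27: R5 pairing).
-/

noncomputable section

open scoped BigOperators
open Finset

namespace Literature.MathematicalPhysics.QuantumFieldTheory.Balaban1983to89.B7Ineq139PathMass

open B7Prop1Explicit B7Prop1Local B7Prop3GeneralRotated B7Prop5GeneralOperators
open B7Eq78Linearization (conjR conjR_apply)
open B7Prop5Flat (BondIn S1 bondsIn mem_bondsIn)

-- `Site` alone would resolve to the torus sites of `Setup.lean`; re-export the `ℤ^d` sites of `B7Prop1Explicit`.
export B7Prop1Explicit (Site)

variable {d : ℕ}

/-! ## §1 The `ℓ¹` mass of a contour and the majorisation of the rotated sums (58) -/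

section Mass

variable {𝔸 : Type*} [NormedRing 𝔸]

/-- The site carrying the bond traversed by the letter `l` from `x`: `x` itself for a positively oriented letter, `x − e_μ`
for a reversed one (convention (9) «U(−b) = U(b)⁻¹»). [cite: Balaban1985Averaging, (9) p.18] -/
def massSite (x : Site d) (l : Letter d) : Site d := if l.2 then x else x + l.vec

/-- THE `ℓ¹` MASS of the contour `Γ` walked from `x`: `Σ_{b⊂Γ} |A_b|` with multiplicity ([2] (1.8) «A(Γ) = Σ_{b⊂Γ} A_b» with
`|A_b|` in place of `A_b`). [cite: Balaban1985Averaging, (139) p.39; Balaban1984PropagatorsI, (1.8) p.19] -/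
def pathMass (A : Site d → Fin d → 𝔸) : Site d → List (Letter d) → ℝ
  | _, [] => 0
  | x, l :: w => ‖A (massSite x l) l.1‖ + pathMass A (x + l.vec) w

/-- Empty contour. [folklore] -/
@[simp] private theorem pathMass_nil (A : Site d → Fin d → 𝔸) (x : Site d) : pathMass A x [] = 0 := rfl

/-- One letter. [folklore] -/
@[simp] private theorem pathMass_cons (A : Site d → Fin d → 𝔸) (x : Site d) (l : Letter d) (w : List (Letter d)) :
    pathMass A x (l :: w) = ‖A (massSite x l) l.1‖ + pathMass A (x + l.vec) w := rfl

/-- Masses are nonnegative. [folklore] -/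
private theorem pathMass_nonneg (A : Site d → Fin d → 𝔸) : ∀ (x : Site d) (w : List (Letter d)), 0 ≤ pathMass A x w
  | _, [] => le_rfl
  | x, l :: w => by
    rw [pathMass_cons]
    exact add_nonneg (norm_nonneg _) (pathMass_nonneg A (x + l.vec) w)

/-- **THE ROTATED SUM (58) IS MAJORISED BY THE MASS**: over a background with `‖V₀(b)‖, ‖V₀(b)⁻¹‖ ≤ 1` (class `U1`),
`‖(R_{0,x}A)(Γ)‖ ≤ Σ_{b⊂Γ}|A_b|` — the refinement of `B7Prop3GeneralRotated.norm_tsum_le` (`|Γ|·sup|A|`) that (139) needs: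
«the rotations do not increase norms». [cite: Balaban1985Averaging, (139) p.39, (125)–(126) p.36, (58) p.27] -/
theorem norm_tsum_le_pathMass [NormOneClass 𝔸] {V₀ : Site d → Fin d → 𝔸ˣ} (hV₀ : ∀ x κ, V₀ x κ ∈ U1 𝔸)
    (A : Site d → Fin d → 𝔸) : ∀ (x : Site d) (w : List (Letter d)), ‖tsum V₀ A x w‖ ≤ pathMass A x w
  | x, [] => by simp
  | x, l :: w => by
    rw [tsum_cons, pathMass_cons]
    refine (norm_add_le _ _).trans (add_le_add ?_ ?_)
    · unfold tstep massSite
      split_ifs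
      · exact le_rfl
      · rw [norm_neg]
        exact norm_conjR_le (stepHol_mem hV₀ x l) _
    · exact (norm_conjR_le (stepHol_mem hV₀ x l) _).trans (norm_tsum_le_pathMass hV₀ A (x + l.vec) w)

/-! ## §2 Monotone (positively oriented) walks: distinct bonds, hence mass `≤` the mass of any covering bond set -/

/-- The bonds `(site, direction)` of the contour `Γ` walked from `x`, in order (conventions (9), contours (14)). [cite: Balaban1985Averaging, (9) p.18, (14) p.19] -/
def pathBonds : Site d → List (Letter d) → List (Site d × Fin d)
  | _, [] => []
  | x, l :: w => (massSite x l, l.1) :: pathBonds (x + l.vec) w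

/-- Empty contour. [folklore] -/
@[simp] private theorem pathBonds_nil (x : Site d) : pathBonds x ([] : List (Letter d)) = [] := rfl

/-- One letter. [folklore] -/
@[simp] private theorem pathBonds_cons (x : Site d) (l : Letter d) (w : List (Letter d)) :
    pathBonds x (l :: w) = (massSite x l, l.1) :: pathBonds (x + l.vec) w := rfl

omit [NormedRing 𝔸] in
/-- A positively oriented letter moves by `+e_μ`. [folklore] -/
private theorem vec_of_pos {l : Letter d} (hl : l.2 = true) : l.vec = e l.1 := by simp [Letter.vec, hl]

omit [NormedRing 𝔸] in
/-- … and its bond sits at the current site. [folklore] -/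
private theorem massSite_of_pos (x : Site d) {l : Letter d} (hl : l.2 = true) : massSite x l = x := by simp [massSite, hl]

omit [NormedRing 𝔸] in
/-- `0 ≤ e_μ` coordinatewise. [folklore] -/
private theorem e_nonneg (μ i : Fin d) : (0 : ℤ) ≤ e μ i := by
  rw [e_apply]
  split_ifs <;> norm_num

omit [NormedRing 𝔸] in
/-- The displacement of a positively oriented word is coordinatewise nonnegative. [folklore] -/
private theorem disp_nonneg : ∀ {w : List (Letter d)}, (∀ l ∈ w, l.2 = true) → ∀ i, (0 : ℤ) ≤ disp w i
  | [], _, i => by simp [disp]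
  | l :: w, hw, i => by
    rw [disp_cons, Pi.add_apply, vec_of_pos (hw l (by simp))]
    exact add_nonneg (e_nonneg _ _) (disp_nonneg (fun l' hl' => hw l' (by simp [hl'])) i)

omit [NormedRing 𝔸] in
/-- THE SITES OF A MONOTONE WALK: every bond `(s, μ)` of a positively oriented word walked from `x` has `s = x + v` with
`0 ≤ v` and `v + e_μ ≤ disp Γ` coordinatewise (both endpoints lie in the box `[x, x + disp Γ]`). [folklore] -/
private theorem pathBonds_pos : ∀ {x : Site d} {w : List (Letter d)}, (∀ l ∈ w, l.2 = true) →
    ∀ b ∈ pathBonds x w, ∃ v : Site d, (∀ i, 0 ≤ v i) ∧ (∀ i, v i + e b.2 i ≤ disp w i) ∧ b.1 = x + v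
  | x, [], _, b, hb => by simp at hb
  | x, l :: w, hw, b, hb => by
    have hl : l.2 = true := hw l (by simp)
    have hw' : ∀ l' ∈ w, l'.2 = true := fun l' hl' => hw l' (by simp [hl'])
    rw [pathBonds_cons, List.mem_cons] at hb
    rcases hb with rfl | hb
    · refine ⟨0, fun i => le_rfl, fun i => ?_, by rw [massSite_of_pos x hl, add_zero]⟩
      rw [disp_cons, Pi.add_apply, vec_of_pos hl, Pi.zero_apply, zero_add]
      exact le_add_of_nonneg_right (disp_nonneg hw' i)
    · obtain ⟨v, hv0, hv1, hb1⟩ := pathBonds_pos hw' b hb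
      refine ⟨l.vec + v, fun i => ?_, fun i => ?_, by rw [hb1, add_assoc]⟩
      · rw [Pi.add_apply, vec_of_pos hl]
        exact add_nonneg (e_nonneg _ _) (hv0 i)
      · rw [disp_cons, Pi.add_apply, Pi.add_apply, add_assoc]
        exact add_le_add le_rfl (hv1 i)

omit [NormedRing 𝔸] in
/-- The first bond of a monotone walk is not revisited. [folklore] -/
private theorem head_not_mem_pathBonds {x : Site d} {μ : Fin d} {w : List (Letter d)} (hw : ∀ l ∈ w, l.2 = true) :
    (x, μ) ∉ pathBonds (x + e μ) w := by
  intro h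
  obtain ⟨v, hv0, -, hb1⟩ := pathBonds_pos hw (x, μ) h
  have h1 := congrArg (fun s : Site d => s μ) hb1
  simp only [Pi.add_apply, e_apply, if_true] at h1
  have := hv0 μ
  omega

/-- **MASS OF A MONOTONE WALK ≤ MASS OF ANY COVERING BOND SET**: if every bond of a positively oriented contour walked from
`x` lies in the finite bond set `T`, then `Σ_{b⊂Γ}|A_b| ≤ Σ_{b∈T}|A_b|` (the walk's bonds are pairwise distinct). [folklore] -/
private theorem pathMass_le_sum (A : Site d → Fin d → 𝔸) : ∀ (x : Site d) (w : List (Letter d)) (T : Finset (Site d × Fin d)),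
    (∀ l ∈ w, l.2 = true) → (∀ b ∈ pathBonds x w, b ∈ T) → pathMass A x w ≤ ∑ b ∈ T, ‖A b.1 b.2‖
  | x, [], T, _, _ => by
    rw [pathMass_nil]
    exact sum_nonneg fun b _ => norm_nonneg _
  | x, l :: w, T, hw, hT => by
    have hl : l.2 = true := hw l (by simp)
    have hw' : ∀ l' ∈ w, l'.2 = true := fun l' hl' => hw l' (by simp [hl'])
    have hhead : (x, l.1) ∈ T := by
      have h := hT (massSite x l, l.1) (by simp)
      rwa [massSite_of_pos x hl] at h
    have htail : ∀ b ∈ pathBonds (x + l.vec) w, b ∈ T.erase (x, l.1) := by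
      intro b hb
      refine mem_erase.2 ⟨?_, hT b (by simp [hb])⟩
      rintro rfl
      rw [vec_of_pos hl] at hb
      exact head_not_mem_pathBonds hw' hb
    rw [pathMass_cons, massSite_of_pos x hl, ← add_sum_erase T (fun b => ‖A b.1 b.2‖) hhead]
    exact add_le_add le_rfl (pathMass_le_sum A (x + l.vec) w (T.erase (x, l.1)) hw' htail)

end Mass

/-! ## §3 The contours of (115)/(124)/(125) live in «b ⊂ B(c₋) ∪ B(c₊)» = `S1 L q κ` -/

section Blocks

variable (L : ℕ)

/-- The straight segment `[x, x(c)]` is positively oriented. [folklore] -/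
private theorem seg_pos (κ : Fin d) : ∀ l ∈ seg κ (L : ℤ), l.2 = true := by
  intro l hl
  rw [seg_natCast, List.mem_replicate] at hl
  rw [hl.2]

/-- The tree contour `Γ_{y,y+v}` of a nonnegative `v` is positively oriented. [folklore] -/
private theorem treeWord_pos {v : Site d} (hv : ∀ i, 0 ≤ v i) : ∀ l ∈ treeWord v, l.2 = true := by
  intro l hl
  simp only [treeWord, List.mem_flatMap, List.mem_reverse, List.mem_finRange, true_and] at hl
  obtain ⟨κ, hκ⟩ := hl
  have hvκ : v κ = ((v κ).toNat : ℤ) := (Int.toNat_of_nonneg (hv κ)).symm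
  rw [hvκ, seg_natCast, List.mem_replicate] at hκ
  rw [hκ.2]

/-- `boxVec` is nonnegative. [folklore] -/
private theorem boxVec_nonneg (r : Fin d → Fin L) (i : Fin d) : (0 : ℤ) ≤ boxVec L r i := by
  simp [boxVec]

/-- `boxVec ≤ L − 1` coordinatewise. [folklore] -/
private theorem boxVec_le (r : Fin d → Fin L) (i : Fin d) : boxVec L r i ≤ (L : ℤ) - 1 := by
  have := (r i).isLt
  simp only [boxVec]
  omega

/-- A bond `(s, μ)` with `q ≤ s` and `s + e_μ ≤ q + (L−1)𝟙 + Le_κ` coordinatewise lies in `S1 L q κ` («b ⊂ B(c₋) ∪ B(c₊)»: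
both endpoints in the box `[q, q + (L−1)𝟙 + Le_κ]`). [cite: Balaban1985Averaging, (140) p.39, p.24 (after (43))] -/
theorem mem_S1_of_le {q s : Site d} {μ κ : Fin d} (h0 : ∀ i, q i ≤ s i)
    (h1 : ∀ i, s i + e μ i ≤ q i + ((L : ℤ) - 1) + if i = κ then (L : ℤ) else 0) : (s, μ) ∈ S1 L q κ := by
  refine mem_bondsIn.2 ⟨fun i => ⟨h0 i, ?_⟩, fun i => ⟨?_, ?_⟩⟩
  · have := h1 i; have := e_nonneg (d := d) μ i
    simp only [bondHi]
    omega
  · have := h0 i; have := e_nonneg (d := d) μ i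
    simp only [Pi.add_apply]
    omega
  · have := h1 i
    simp only [bondHi, Pi.add_apply]
    omega

/-- THE TREE CONTOUR LIVES IN ITS BLOCK: every bond of `Γ_{c₋,x}`, `x = q + r`, `r ∈ [0, L)ᵈ`, has both endpoints in `B(c₋)`,
hence lies in `S1 L q κ` for every `κ`. [cite: Balaban1985Averaging, (14) p.19, (140) p.39] -/
theorem pathBonds_treeWord_subset (q : Site d) (κ : Fin d) (r : Fin d → Fin L) :
    ∀ b ∈ pathBonds q (treeWord (boxVec L r)), b ∈ S1 L q κ := by
  intro b hb
  obtain ⟨v, hv0, hv1, hb1⟩ := pathBonds_pos (treeWord_pos (boxVec_nonneg L r)) b hb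
  rw [disp_treeWord] at hv1
  have hb' : b = (b.1, b.2) := rfl
  rw [hb', hb1]
  refine mem_S1_of_le L (fun i => ?_) (fun i => ?_)
  · have := hv0 i; simp only [Pi.add_apply]; omega
  · have := hv1 i; have := boxVec_le L r i
    simp only [Pi.add_apply]
    split_ifs <;> omega

/-- THE TREE CONTOUR OF THE SECOND BLOCK: every bond of `Γ_{c₊,x′}`, `c₊ = q + Le_κ`, `x′ = c₊ + r`, has both endpoints in
`B(c₊)`, hence lies in `S1 L q κ`. [cite: Balaban1985Averaging, (14) p.19, (140) p.39] -/
theorem pathBonds_treeWord_subset' (q : Site d) (κ : Fin d) (r : Fin d → Fin L) :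
    ∀ b ∈ pathBonds (q + (L : ℤ) • e κ) (treeWord (boxVec L r)), b ∈ S1 L q κ := by
  intro b hb
  obtain ⟨v, hv0, hv1, hb1⟩ := pathBonds_pos (treeWord_pos (boxVec_nonneg L r)) b hb
  rw [disp_treeWord] at hv1
  have hb' : b = (b.1, b.2) := rfl
  rw [hb', hb1]
  refine mem_S1_of_le L (fun i => ?_) (fun i => ?_)
  · have := hv0 i
    rw [Pi.add_apply, add_zsmul_e_apply]
    split_ifs <;> omega
  · have := hv1 i; have := boxVec_le L r i
    rw [Pi.add_apply, add_zsmul_e_apply]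
    split_ifs <;> omega

/-- The bonds of the straight segment `[x, x + ne_κ]`: `(x + le_κ, κ)`, `l < n`. [folklore] -/
private theorem pathBonds_replicate (κ : Fin d) : ∀ (n : ℕ) (x : Site d),
    ∀ b ∈ pathBonds x (List.replicate n (κ, true)), ∃ l : ℕ, l < n ∧ b = (x + (l : ℤ) • e κ, κ)
  | 0, x, b, hb => by simp at hb
  | n + 1, x, b, hb => by
    rw [List.replicate_succ, pathBonds_cons, List.mem_cons] at hb
    rcases hb with rfl | hb
    · exact ⟨0, Nat.succ_pos n, by simp [massSite]⟩
    · have hv : Letter.vec ((κ, true) : Letter d) = e κ := by simp [Letter.vec]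
      rw [hv] at hb
      obtain ⟨l, hl, rfl⟩ := pathBonds_replicate κ n (x + e κ) b hb
      refine ⟨l + 1, Nat.succ_lt_succ hl, ?_⟩
      simp only [Nat.cast_succ, add_smul, one_smul, Prod.mk.injEq, and_true]
      abel

/-- THE STRAIGHT SEGMENT LIVES IN THE TWO BLOCKS: every bond of `[x, x(c)]`, `x ∈ B(c₋)` (i.e. `q ≤ x ≤ q + (L−1)𝟙`), lies in
`S1 L q κ` ([2] (1.8): `x(c) = x + Le_κ ∈ B(c₊)`). [cite: Balaban1985Averaging, (140) p.39; Balaban1984PropagatorsI, (1.8) p.19] -/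
theorem pathBonds_seg_subset {q x : Site d} (κ : Fin d) (hx0 : ∀ i, q i ≤ x i) (hx1 : ∀ i, x i ≤ q i + ((L : ℤ) - 1)) :
    ∀ b ∈ pathBonds x (seg κ (L : ℤ)), b ∈ S1 L q κ := by
  intro b hb
  rw [seg_natCast] at hb
  obtain ⟨l, hl, rfl⟩ := pathBonds_replicate κ L x b hb
  refine mem_S1_of_le L (fun i => ?_) (fun i => ?_)
  · have := hx0 i
    rw [add_zsmul_e_apply]
    split_ifs <;> omega
  · have := hx1 i
    rw [add_zsmul_e_apply, e_apply]
    split_ifs <;> omega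

/-! ### The masses of the pieces of the loop `Γ_{c,x} ∪ (−c)` and of the segment `[x, x(c)]` -/

variable {𝔸 : Type*} [NormedRing 𝔸]

/-- THE TWO-BLOCK MASS `Σ_{b ⊂ B(c₋)∪B(c₊)} |A_b| = Lᵈ·(Q″|A|)_c` ((140), `B7Prop5GeneralOperators.ddQ`). [cite: Balaban1985Averaging, (140) p.39] -/
theorem sum_S1_eq_ddQ (hL : 0 < L) (A : Site d → Fin d → 𝔸) (q : Site d) (κ : Fin d) :
    ∑ b ∈ S1 L q κ, ‖A b.1 b.2‖ = (L : ℝ) ^ d * ddQ L (fun x μ => ‖A x μ‖) q κ := by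
  have hL0 : ((L : ℝ) ^ d) ≠ 0 := pow_ne_zero d (by exact_mod_cast hL.ne')
  rw [ddQ, ← mul_assoc, mul_inv_cancel₀ hL0, one_mul]

/-- Mass of the tree contour `Γ_{c₋,x}` `≤` the two-block mass. [cite: Balaban1985Averaging, (139)–(140) p.39] -/
theorem pathMass_treeWord_le (A : Site d → Fin d → 𝔸) (q : Site d) (κ : Fin d) (r : Fin d → Fin L) :
    pathMass A q (treeWord (boxVec L r)) ≤ ∑ b ∈ S1 L q κ, ‖A b.1 b.2‖ :=
  pathMass_le_sum A _ _ _ (treeWord_pos (boxVec_nonneg L r)) (pathBonds_treeWord_subset L q κ r)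

/-- Mass of the tree contour `Γ_{c₊,x′}` in the second block `≤` the two-block mass. [cite: Balaban1985Averaging, (139)–(140) p.39] -/
theorem pathMass_treeWord_le' (A : Site d → Fin d → 𝔸) (q : Site d) (κ : Fin d) (r : Fin d → Fin L) :
    pathMass A (q + (L : ℤ) • e κ) (treeWord (boxVec L r)) ≤ ∑ b ∈ S1 L q κ, ‖A b.1 b.2‖ :=
  pathMass_le_sum A _ _ _ (treeWord_pos (boxVec_nonneg L r)) (pathBonds_treeWord_subset' L q κ r)

/-- Mass of the straight segment `[x, x(c)]` from a site `x = q + r` of `B(c₋)` `≤` the two-block mass. [cite: Balaban1985Averaging, (139)–(140) p.39] -/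
theorem pathMass_seg_le (A : Site d → Fin d → 𝔸) (q : Site d) (κ : Fin d) (r : Fin d → Fin L) :
    pathMass A (q + boxVec L r) (seg κ (L : ℤ)) ≤ ∑ b ∈ S1 L q κ, ‖A b.1 b.2‖ :=
  pathMass_le_sum A _ _ _ (seg_pos L κ) (pathBonds_seg_subset L κ
    (fun i => by have := boxVec_nonneg L r i; simp only [Pi.add_apply]; omega)
    (fun i => by have := boxVec_le L r i; simp only [Pi.add_apply]; omega))

/-- Mass of the coarse bond `c = [c₋, c₊]` itself (the segment from the corner) `≤` the two-block mass. [cite: Balaban1985Averaging, (139)–(140) p.39] -/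
theorem pathMass_seg_corner_le (hL : 0 < L) (A : Site d → Fin d → 𝔸) (q : Site d) (κ : Fin d) :
    pathMass A q (seg κ (L : ℤ)) ≤ ∑ b ∈ S1 L q κ, ‖A b.1 b.2‖ := by
  have hL1 : (1 : ℤ) ≤ L := by exact_mod_cast hL
  exact pathMass_le_sum A _ _ _ (seg_pos L κ) (pathBonds_seg_subset L κ (fun _ => le_rfl) (fun i => by omega))

/-- The mass of a straight segment, explicitly: `Σ_{l<n} |A(x + le_κ, κ)|`. [folklore] -/
private theorem pathMass_replicate (A : Site d → Fin d → 𝔸) (κ : Fin d) : ∀ (n : ℕ) (x : Site d),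
    pathMass A x (List.replicate n (κ, true)) = ∑ l ∈ range n, ‖A (x + (l : ℤ) • e κ) κ‖
  | 0, x => by simp
  | n + 1, x => by
    have hv : Letter.vec ((κ, true) : Letter d) = e κ := by simp [Letter.vec]
    rw [List.replicate_succ, pathMass_cons, pathMass_replicate A κ n, sum_range_succ', hv]
    simp only [massSite, if_true, Nat.cast_zero, zero_smul, add_zero, Nat.cast_succ, add_smul, one_smul]
    rw [add_comm]
    refine congrArg₂ (· + ·) (sum_congr rfl fun l _ => ?_) rfl
    rw [add_assoc, add_comm (e κ)]

/-- **THE MAIN TERM'S MAJORANT IS PRINT'S `Q`** ([2] (1.11), times the un-normalisation `L` of (122)):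
`L · Σ_{x∈B(c₋)} L^{−(d+1)} Σ_{b⊂[x,x(c)]} |A_b| = avQ L |A| (c)` EXACTLY (`B7Prop5GeneralOperators.avQ`).
[cite: Balaban1985Averaging, (139) p.39, (125) p.36; Balaban1984PropagatorsI, (1.11) p.19] -/
theorem sum_pathMass_seg_eq_avQ (hL : 0 < L) (A : Site d → Fin d → 𝔸) (q : Site d) (κ : Fin d) :
    (L : ℝ) * ∑ r : Fin d → Fin L, ((L : ℝ) ^ (d + 1))⁻¹ * pathMass A (q + boxVec L r) (seg κ (L : ℤ)) =
      avQ L (fun x μ => ‖A x μ‖) q κ := by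
  have hL0 : (L : ℝ) ≠ 0 := by exact_mod_cast hL.ne'
  have hc : (L : ℝ) * ((L : ℝ) ^ (d + 1))⁻¹ = ((L : ℝ) ^ d)⁻¹ := by
    rw [pow_succ, mul_inv, mul_comm (((L : ℝ) ^ d)⁻¹), ← mul_assoc, mul_inv_cancel₀ hL0, one_mul]
  rw [avQ, mul_sum]
  refine sum_congr rfl fun r _ => ?_
  rw [← mul_assoc, hc, seg_natCast, pathMass_replicate, Finset.sum_range]

end Blocks

end Literature.MathematicalPhysics.QuantumFieldTheory.Balaban1983to89.B7Ineq139PathMass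

end
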